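import Literature.AlgebraicGeometry.AbelianSchemes.AbelianSchemeCotangentCharpoly   -- ★ p844516 ∕ p844636 (A-p01 g22, D2b ED. 1–2): `UnitCotangent`, `cotangentCharpoly`, `lieCharpoly`
import Literature.AlgebraicGeometry.Morphisms.SectionConormalBaseChange          -- (D2c-ii) A-p01 (g22): equivariant base change of `sectionConormalEndo`, `charpoly_sectionConormalEndo_baseChange`
import Literature.AlgebraicGeometry.AbelianSchemes.AbelianSchemeChartBaseChange     -- ★ A-p14: `bcFst`, `bcChart`, `isPullback_bcFst`, `unit_preimage_bcChart_eq_top`, `isAffineOpen_bcChart`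
import HarnessLib

/-!
# The cotangent characteristic polynomial of an abelian scheme COMMUTES WITH BASE CHANGE:
# `(𝒜 ⊗_R T).cotangentCharpoly (v ×_R T) = (𝒜.cotangentCharpoly v).map (R → T)`, `lieCharpoly_baseChange` (Kottwitz 1992 §5; Görtz–Wedhorn II Rem. 17.15)

Topic `Literature/AlgebraicGeometry/AbelianSchemes`; namespace `Literature.AlgebraicGeometry.AbelianSchemes.AbelianScheme`.  THEOREMS ONLY (no definition, no instance,
no notation, no named fact, no `sorry`).  Cell `pub/hodgecm-mathlib` (D-0151), programme P6 «MOD», ROW 3 organ L3.1∕L3.2, brick **(D2b-BC)** of A-p01 (g22) = the abelian-scheme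
dress of (D2c-ii) ★ `Morphisms/SectionConormalBaseChange.charpoly_sectionConormalEndo_baseChange` on A-p14's ★ base-changed unit-section chart
(`AbelianSchemeChartBaseChange`: `W_T = p⁻¹W`, `p = bcFst : 𝒜_T → 𝒜`, `η_T ≫ p = Spec(R → T) ≫ η` = A-p11 ★ `unit_baseChange_left_comp_fst`).  This is the
«formation commutes with base change» half of the Kottwitz determinant condition ([Kottwitz1992] §5 p. 390: the condition is stable under base change because
`Lie(A ⊗_R T) = Lie(A) ⊗_R T` and characteristic polynomials are compatible with extension of scalars); kit author A-p07 (g17); F0P6a-plan (g0) 13:25:02Z forward note.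

WHAT IS HERE (`𝒜 : AbelianScheme R`, `T` a commutative `R`-algebra, `W` an affine unit-section chart of `𝒜`):
* `free_∕finite_unitCotangent_baseChange` — `ω` free ∕ finite over `R` on `W` ⇒ `ω_T` free ∕ finite over `T` on `W_T`;
* **`cotangentCharpoly_baseChange`** — for `v` fixing the unit and ANY endomorphism `vT` of `𝒜_T` over `v` (`vT.left ≫ p = p ≫ v.left`) fixing the unit:
  `(𝒜_T).cotangentCharpoly (W_T) vT = (𝒜.cotangentCharpoly W v).map (algebraMap R T)`;
* `unit_left_comp_pullback_map_left`, `pullback_map_left_comp_bcFst` — the canonical `v_T = (Over.pullback (Spec (R → T))).map v` qualifies; `cotangentCharpoly_baseChange_map`;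
* over LOCAL `R`, `T` (chart-free ★ `lieCharpoly`): **`lieCharpoly_baseChange`**, `lieCharpoly_baseChange_map`.

## References
* [Kottwitz1992] R. E. Kottwitz, *Points on some Shimura varieties over finite fields*, JAMS 5 (1992): §5 p. 390.
* [GortzWedhorn2023] U. Görtz, T. Wedhorn, *Algebraic Geometry II* (2023): Remark 17.14, Remark 17.15 (1), Def. 27.17.
* [GortzWedhorn2020] U. Görtz, T. Wedhorn, *Algebraic Geometry I*, 2nd ed. (2020): Section (4.7), Remark 16.54.
* [EGAIV4] A. Grothendieck, J. Dieudonné, *EGA IV₄* (1967): (16.2.3 (ii)), (16.4.9).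
-/

set_option autoImplicit false

noncomputable section

open CategoryTheory CategoryTheory.Limits AlgebraicGeometry TopologicalSpace Opposite Polynomial MonObj
open Literature.RingTheory.Smooth Literature.AlgebraicGeometry.Morphisms Literature.AlgebraicGeometry.Morphisms.ChartRing

universe u

namespace Literature.AlgebraicGeometry.AbelianSchemes.AbelianScheme

variable {R : Type u} [CommRing R] (𝒜 : AbelianScheme R)

section BaseChange

variable (T : Type u) [CommRing T] [Algebra R T] {W : 𝒜.left.Opens} (hW : IsAffineOpen W) (heW : η[𝒜.X].left ⁻¹ᵁ W = ⊤)

include hW in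
/-- `ω` free over `R` on the chart `W` ⇒ `ω_T` free over `T` on the base-changed chart `W_T = p⁻¹W` ((D2c-ii) `free_cotangent_sectionAug_baseChange`).
[cite: EGAIV4, (16.2.3) and (16.4.9)] [cite: GortzWedhorn2023, Remark 17.15 (1)] -/
theorem free_unitCotangent_baseChange [Module.Free R (𝒜.UnitCotangent heW)] :
    Module.Free T ((𝒜.baseChange (algebraMap R T)).UnitCotangent (𝒜.unit_preimage_bcChart_eq_top T heW)) :=
  free_cotangent_sectionAug_baseChange 𝒜.X.hom (𝒜.bcFst T) (𝒜.baseChange (algebraMap R T)).X.hom (𝒜.isPullback_bcFst T) η[𝒜.X].left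
    𝒜.unit_left_comp_hom hW heW η[(𝒜.baseChange (algebraMap R T)).X].left (𝒜.baseChange (algebraMap R T)).unit_left_comp_hom
    (𝒜.unit_baseChange_left_comp_fst (algebraMap R T)) (𝒜.unit_preimage_bcChart_eq_top T heW)

include hW in
/-- `ω` finite over `R` on `W` ⇒ `ω_T` finite over `T` on `W_T`. [cite: EGAIV4, (16.2.3) and (16.4.9)] [cite: GortzWedhorn2023, Remark 17.15 (1)] -/
theorem finite_unitCotangent_baseChange [Module.Finite R (𝒜.UnitCotangent heW)] :
    Module.Finite T ((𝒜.baseChange (algebraMap R T)).UnitCotangent (𝒜.unit_preimage_bcChart_eq_top T heW)) :=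
  finite_cotangent_sectionAug_baseChange 𝒜.X.hom (𝒜.bcFst T) (𝒜.baseChange (algebraMap R T)).X.hom (𝒜.isPullback_bcFst T) η[𝒜.X].left
    𝒜.unit_left_comp_hom hW heW η[(𝒜.baseChange (algebraMap R T)).X].left (𝒜.baseChange (algebraMap R T)).unit_left_comp_hom
    (𝒜.unit_baseChange_left_comp_fst (algebraMap R T)) (𝒜.unit_preimage_bcChart_eq_top T heW)

variable (v : 𝒜.X ⟶ 𝒜.X) (hev : η[𝒜.X].left ≫ v.left = η[𝒜.X].left)
  (vT : (𝒜.baseChange (algebraMap R T)).X ⟶ (𝒜.baseChange (algebraMap R T)).X)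
  (hevT : η[(𝒜.baseChange (algebraMap R T)).X].left ≫ vT.left = η[(𝒜.baseChange (algebraMap R T)).X].left)
  (hpv : vT.left ≫ 𝒜.bcFst T = 𝒜.bcFst T ≫ v.left)

include hpv in
/-- **THE COTANGENT CHARACTERISTIC POLYNOMIAL COMMUTES WITH BASE CHANGE**: for an endomorphism `v` of `𝒜` fixing the unit and ANY endomorphism `vT` of
`𝒜_T = 𝒜 ⊗_R T` over it (`vT ≫ p = p ≫ v`, `p : 𝒜_T → 𝒜` the projection; e.g. `v ×_R T`) fixing the unit, the cotangent characteristic polynomial of `vT` on the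
base-changed chart `W_T` is the image under `R → T` of that of `v` on `W` ((D2c-ii) `charpoly_sectionConormalEndo_baseChange`; both sides computed with the shrinking
element `h` resp. `p^♯ h`, `cotangentCharpoly_eq_charpoly_sectionConormalEndo`). [cite: GortzWedhorn2023, Remark 17.14 and Remark 17.15 (1)] [cite: EGAIV4, (16.2.3) and (16.4.9)]
[cite: Kottwitz1992, §5 p. 390] -/
theorem cotangentCharpoly_baseChange [Module.Free R (𝒜.UnitCotangent heW)] [Module.Finite R (𝒜.UnitCotangent heW)]
    [Module.Free T ((𝒜.baseChange (algebraMap R T)).UnitCotangent (𝒜.unit_preimage_bcChart_eq_top T heW))]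
    [Module.Finite T ((𝒜.baseChange (algebraMap R T)).UnitCotangent (𝒜.unit_preimage_bcChart_eq_top T heW))] :
    (𝒜.baseChange (algebraMap R T)).cotangentCharpoly (𝒜.isAffineOpen_bcChart T hW) (𝒜.unit_preimage_bcChart_eq_top T heW) vT hevT =
      (𝒜.cotangentCharpoly hW heW v hev).map (algebraMap R T) := by
  obtain ⟨h, hh, hhv⟩ := 𝒜.exists_shrink_unitSectionChart hW heW v hev
  rw [𝒜.cotangentCharpoly_eq_charpoly_sectionConormalEndo hW heW v hev h hhv hh,
    (𝒜.baseChange (algebraMap R T)).cotangentCharpoly_eq_charpoly_sectionConormalEndo (𝒜.isAffineOpen_bcChart T hW)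
      (𝒜.unit_preimage_bcChart_eq_top T heW) vT hevT (ChartRing.mk _ _ ((𝒜.bcFst T).app W (val h)))
      (basicOpen_app_le_preimage 𝒜.X.hom (𝒜.bcFst T) (𝒜.baseChange (algebraMap R T)).X.hom h v.left hhv vT.left hpv)
      (sectionAug_mk_app_eq_one 𝒜.X.hom (𝒜.bcFst T) (𝒜.baseChange (algebraMap R T)).X.hom h η[𝒜.X].left 𝒜.unit_left_comp_hom
        η[(𝒜.baseChange (algebraMap R T)).X].left (𝒜.baseChange (algebraMap R T)).unit_left_comp_hom
        (𝒜.unit_baseChange_left_comp_fst (algebraMap R T)) heW (𝒜.unit_preimage_bcChart_eq_top T heW) hh)]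
  exact charpoly_sectionConormalEndo_baseChange 𝒜.X.hom (𝒜.bcFst T) (𝒜.baseChange (algebraMap R T)).X.hom (𝒜.isPullback_bcFst T)
    η[𝒜.X].left 𝒜.unit_left_comp_hom hW heW η[(𝒜.baseChange (algebraMap R T)).X].left (𝒜.baseChange (algebraMap R T)).unit_left_comp_hom
    (𝒜.unit_baseChange_left_comp_fst (algebraMap R T)) (𝒜.unit_preimage_bcChart_eq_top T heW) v.left (𝒜.left_comp_hom v) hev h hhv hh
    vT.left ((𝒜.baseChange (algebraMap R T)).left_comp_hom vT) hevT hpv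

include hev in
/-- **The canonical base change `v_T = v ×_R T` fixes the unit** when `v` does (the unit of `𝒜_T` is `ε ≫ (v ↦ v ×_R T)(η)`, Mathlib `Functor.obj.η_def`).
[cite: GortzWedhorn2020, Remark 16.54] -/
theorem unit_left_comp_pullback_map_left :
    η[(𝒜.baseChange (algebraMap R T)).X].left ≫ ((Over.pullback (specMap (algebraMap R T))).map v).left =
      η[(𝒜.baseChange (algebraMap R T)).X].left := by
  have hev' : η[𝒜.X] ≫ v = η[𝒜.X] := Over.OverMorphism.ext hev
  have h1 : η[(𝒜.baseChange (algebraMap R T)).X] ≫ (Over.pullback (specMap (algebraMap R T))).map v =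
      η[(𝒜.baseChange (algebraMap R T)).X] :=
    calc η[(𝒜.baseChange (algebraMap R T)).X] ≫ (Over.pullback (specMap (algebraMap R T))).map v
        = (Functor.LaxMonoidal.ε (Over.pullback (specMap (algebraMap R T))) ≫
            (Over.pullback (specMap (algebraMap R T))).map η[𝒜.X]) ≫ (Over.pullback (specMap (algebraMap R T))).map v := rfl
      _ = Functor.LaxMonoidal.ε (Over.pullback (specMap (algebraMap R T))) ≫
            (Over.pullback (specMap (algebraMap R T))).map (η[𝒜.X] ≫ v) := by rw [Category.assoc, Functor.map_comp]
      _ = Functor.LaxMonoidal.ε (Over.pullback (specMap (algebraMap R T))) ≫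
            (Over.pullback (specMap (algebraMap R T))).map η[𝒜.X] := by rw [hev']
      _ = η[(𝒜.baseChange (algebraMap R T)).X] := rfl
  rw [← Over.comp_left, h1]

/-- **`v_T ≫ p = p ≫ v`** for the canonical base change (`(v ↦ v ×_R T)(v)` is a `pullback.lift`, Mathlib `Over.pullback`). [cite: GortzWedhorn2020, Section (4.7)] -/
theorem pullback_map_left_comp_bcFst :
    ((Over.pullback (specMap (algebraMap R T))).map v).left ≫ 𝒜.bcFst T = 𝒜.bcFst T ≫ v.left :=
  pullback.lift_fst _ _ _

/-- `cotangentCharpoly_baseChange` for the canonical `v_T = v ×_R T`. [cite: GortzWedhorn2023, Remark 17.14 and Remark 17.15 (1)] [cite: Kottwitz1992, §5 p. 390] -/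
theorem cotangentCharpoly_baseChange_map [Module.Free R (𝒜.UnitCotangent heW)] [Module.Finite R (𝒜.UnitCotangent heW)]
    [Module.Free T ((𝒜.baseChange (algebraMap R T)).UnitCotangent (𝒜.unit_preimage_bcChart_eq_top T heW))]
    [Module.Finite T ((𝒜.baseChange (algebraMap R T)).UnitCotangent (𝒜.unit_preimage_bcChart_eq_top T heW))] :
    (𝒜.baseChange (algebraMap R T)).cotangentCharpoly (𝒜.isAffineOpen_bcChart T hW) (𝒜.unit_preimage_bcChart_eq_top T heW)
        ((Over.pullback (specMap (algebraMap R T))).map v) (𝒜.unit_left_comp_pullback_map_left T v hev) =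
      (𝒜.cotangentCharpoly hW heW v hev).map (algebraMap R T) :=
  𝒜.cotangentCharpoly_baseChange T hW heW v hev _ _ (𝒜.pullback_map_left_comp_bcFst T v)

include hpv in
/-- **`lieCharpoly` COMMUTES WITH BASE CHANGE between LOCAL rings**: `(𝒜_T).lieCharpoly vT = (𝒜.lieCharpoly v).map (R → T)` for any `R`-algebra `T` with `R`, `T` local
(the chart-free polynomials of §5 read on a unit-section chart `W` of `𝒜` with free `ω` and on `W_T`; `cotangentCharpoly_baseChange`). [cite: Kottwitz1992, §5 p. 390]
[cite: GortzWedhorn2023, Remark 17.15 (1) and Def. 27.17] -/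
theorem lieCharpoly_baseChange [IsLocalRing R] [IsLocalRing T] {g : ℕ} (h𝒜 : 𝒜.IsOfRelDim g) :
    (𝒜.baseChange (algebraMap R T)).lieCharpoly (h𝒜.baseChange (algebraMap R T)) vT hevT = (𝒜.lieCharpoly h𝒜 v hev).map (algebraMap R T) := by
  obtain ⟨W, hW, heW, hfree, hfin, -⟩ := 𝒜.exists_unitSectionChart_of_isLocalRing h𝒜
  haveI := hfree; haveI := hfin
  haveI := 𝒜.free_unitCotangent_baseChange T hW heW
  haveI := 𝒜.finite_unitCotangent_baseChange T hW heW
  rw [𝒜.lieCharpoly_eq_cotangentCharpoly h𝒜 v hev hW heW,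
    (𝒜.baseChange (algebraMap R T)).lieCharpoly_eq_cotangentCharpoly (h𝒜.baseChange (algebraMap R T)) vT hevT (𝒜.isAffineOpen_bcChart T hW)
      (𝒜.unit_preimage_bcChart_eq_top T heW)]
  exact 𝒜.cotangentCharpoly_baseChange T hW heW v hev vT hevT hpv

/-- `lieCharpoly_baseChange` for the canonical `v_T = v ×_R T`. [cite: Kottwitz1992, §5 p. 390] [cite: GortzWedhorn2023, Remark 17.15 (1)] -/
theorem lieCharpoly_baseChange_map [IsLocalRing R] [IsLocalRing T] {g : ℕ} (h𝒜 : 𝒜.IsOfRelDim g) :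
    (𝒜.baseChange (algebraMap R T)).lieCharpoly (h𝒜.baseChange (algebraMap R T)) ((Over.pullback (specMap (algebraMap R T))).map v)
        (𝒜.unit_left_comp_pullback_map_left T v hev) =
      (𝒜.lieCharpoly h𝒜 v hev).map (algebraMap R T) :=
  𝒜.lieCharpoly_baseChange T v hev _ _ (𝒜.pullback_map_left_comp_bcFst T v) h𝒜

end BaseChange

end Literature.AlgebraicGeometry.AbelianSchemes.AbelianScheme

end
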